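import Literature.Barriers.CriticalPhenomena.PlaquetteWalkHoleRootCutLawSharp
import HarnessLib

/-!
# Barrier catalogue (SAWScalingLimit): ANY CELL — three cells from the walls, removing ANY ONE further cell other than the far
cell's three doors kills nothing: a witness family with no common cell

Leaf of `PlaquetteWalkHoleRootCutLawSharp` (placement `block_hroot_subset_boxMinus_pair`; the witness transport and certificates in
its cone). Setting: the `m × n` box, hole `h` at least three cells from every wall (`3 ≤ h.1`, `h.1 + 4 ≤ m`, `3 ≤ h.2`, `h.2 + 4 ≤ n`),
root plaquette `w = (h.1 + 1, h.2)` rooted at `W`, far cell `(h.1 − 1, h.2)`, and ONE further removed cell `c` — ANY cell of the plane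
other than `w`, the far cell and the far cell's three doors `farS = (h.1 − 1, h.2 − 1)`, `farN = (h.1 − 1, h.2 + 1)`,
`farWW = (h.1 − 2, h.2)` (the FORCED cells: every class-`B2a` walk at the far cell passes through all five; removing a door empties
both routes — `PlaquetteWalkHoleRootFarCellLaw`, `…DiagonalThreeDoor` — and removing `w` or the far cell removes the question).

The lineage's single-cell non-kill theorems are lists (the four corner cells `PlaquetteWalkHoleRootInteriorNoKill`, the ring
`…InteriorRing(Boxes)`, the near cells `…NearCells/NearSet`, the ring + near pairs `…RingNearPairCensus`). This file removes the
list: for an ARBITRARY position of the removed cell, by a covering argument instead of a census —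

* §1 NINE UNMARKED WOUND WITNESSES inside the frame `[0,6]×[−1,5]` (reference root `(4, 2)`): `anyBlockU1…U4` (under; 18–30 arcs) and
  `anyBlockO1…O5` (over; 18–26 arcs), from the lane's constructive generator, chosen so that the cells COMMON TO ALL under blocks
  (resp. all over blocks) are exactly forced cells: ★ `anyCell_under_cover` / `anyCell_over_cover` (`decide`): a cell lying in every
  block of the family is one of `(4,2), (2,2), (2,1), (2,3), (1,2)`.
* §2 ★★★★★ `exists_under_unmarked_of_anyCell` / `exists_over_unmarked_of_anyCell` — hole three cells from every wall, `c` any cell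
  other than the five forced cells, `S ∋ h` any list inside `{h, c}`: each route carries a wound class-`B2a` walk that is `w₁`-free AND
  `w₂`-free off the far cell (the block of the family missing `c − v` fits the box and avoids `S`); ★★★★★ `lawL_box_anyCell_not_killed`
  — hence NONE of the four universal kill statements of LAW L holds: in the interior LAW L's table has no other entry than the three
  doors. (For `c` outside the box or inside no block, every block serves; the content is the finitely many positions near the hole,
  settled uniformly.)

Not in print; venture lane «pcv-sawmu», seat b-step0 gen 30 (`HOME/code/step0/g30/gen/anycell.py`, family `anycell_k1.json`; the lane's
completeness scan certifies the same for every single cell of the frame, FINDING-YB-KILL-FORCED-ZEROS §28 add. 8).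

References: A. Glazman, I. Manolescu, arXiv:1708.00395v3, §1 (Fig. 1, Fig. 2, remark after eq. (1)), §2.1, §4.2 (translation
invariance), Lemma 2.1 [GlazmanManolescu2019]; A. Glazman, Electron. Commun. Probab. 20 (2015) no. 86, Lemma 3.1, proof pp. 6–7
[Glazman2015WeightedSAW]; R. Courant, H. Robbins, *What is Mathematics?* (1941/1958), Ch. V Appendix §2 (the even–odd rule)
[CourantRobbins1958].
-/

noncomputable section

open Set Function Complex

namespace Literature.Barriers.CriticalPhenomena.PlaquetteWalk

open Literature.Probability.RandomPlanarGeometry.SAW.YangBaxter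
open Real Complex

/-! ## §1 The witness family (reference root `w42 = (4, 2)`, hole `(3, 2)`, far cell `(2, 2)`), every position, and the cover lemmas -/

section Witnesses

/-- Any-cell witness block `U1`: the 18 cells of an under wound witness, UNMARKED (one arc per rhombus: `w₁`-free and `w₂`-free off
the far cell), reference root `(4, 2)`, hole `(3, 2)`, far cell `(2, 2)`, inside the frame `[0,6]×[−1,5]`; one of a family whose members have
NO common cell outside the five forced cells (constructive generator `wgen2.py`, seat b-step0 gen 30).
[cite: GlazmanManolescu2019, §2.1 (finite domains of faces)] -/
def anyBlockU142 : List Face :=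
  [(1,0),(1,1),(1,2),(2,0),(2,1),(2,2),(2,3),(3,0),(3,1),(3,3),(4,0),(4,1),(4,2),(4,3),(5,0),(5,1),(5,2),(5,3)]

/-- Its mid-edges (18 arcs). [cite: GlazmanManolescu2019, §1 (definition of the model), Fig. 1] -/
def anyU1Mids : List MidEdge :=
  [.vert 4 2, .slant 4 2, .vert 4 1, .vert 3 1, .slant 2 2, .slant 2 3, .vert 3 3, .vert 4 3, .vert 5 3, .slant 5 3,
  .slant 5 2, .slant 5 1, .vert 5 0, .vert 4 0, .vert 3 0, .vert 2 0, .slant 1 1, .slant 1 2, .vert 2 2]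

/-- The witness as a walk of its block. [cite: GlazmanManolescu2019, §1 (definition of the model), Fig. 1] -/
def anyU1Walk : YBWalk (dom anyBlockU142) (w42.side .W) ((farW w42).side .W) where
  mids := anyU1Mids
  head_eq := by decide
  getLast_eq := by decide
  nodup := by decide
  arc_mem := arc_mem_of_check (by decide)
  isChain := by decide
  noncross := noncross_of_check (by decide)

/-- The labelled witness. [cite: Glazman2015WeightedSAW, Lemma 3.1 (proof, pp. 6–7)] -/
def ωanyU1 : ΩG (dom anyBlockU142) (w42.side .W) (farW w42) := ⟨.W, anyU1Walk⟩

/-- Certificates: first hit `4`, `18` arcs, no later far-cell arc, first side `S`, `w₁`-free and `w₂`-free off the far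
cell, odd eastern-ray count. [cite: Glazman2015WeightedSAW, Lemma 3.1 (proof, pp. 6–7)] [cite: CourantRobbins1958, Ch. V Appendix §2 (the even–odd rule)] -/
theorem ωanyU1_cert : ωanyU1.2.firstHitG = 4 ∧ ωanyU1.2.arcs.length = 18 ∧
    (∀ j < 18, 4 < j → ωanyU1.2.fc j ≠ farW w42) ∧ ωanyU1.2.nth 4 = (farW w42).side .S ∧
    (ωanyU1.2.W1FreeOff (farW w42) ∧ ωanyU1.2.W2FreeOff (farW w42)) ∧
    Odd ((Finset.range 14).filter fun j => eastRayB w42 (ωanyU1.2.nth (4 + j + 1)) = true).card := by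
  refine ⟨by decide, by decide, by decide, by decide, ⟨by unfold YBWalk.W1FreeOff; decide, by unfold YBWalk.W2FreeOff; decide⟩,
    by decide⟩

/-- The block at the root plaquette `w`. [cite: GlazmanManolescu2019, §2.1, §4.2 (translation invariance)] -/
def anyBlockU1 (w : Face) : List Face := anyBlockU142.map (Face.shiftBy (refShift w))

/-- ★★★ The unmarked under wound witness `U1` at EVERY POSITION.
[cite: GlazmanManolescu2019, §4.2 (translation invariance), Lemma 2.1]
[cite: Glazman2015WeightedSAW, Lemma 3.1 (proof, pp. 6–7)] [cite: CourantRobbins1958, Ch. V Appendix §2 (the even–odd rule)] -/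
theorem exists_under_unmarked_of_anyBlockU1 {Dl : List Face} {w : Face} (hB : ∀ c ∈ anyBlockU1 w, c ∈ Dl)
    (hr : RootedFace (dom Dl) (w.side .W) (farW w)) (θ : ℝ) :
    ∃ (ω : ΩG (dom Dl) (w.side .W) (farW w)) (h : ω.IsB2a), ω.2.firstSideG = .S ∧
      ω.WE (fun _ => θ) ≠ excursionWinding θ ω.2.firstSideG (ω.z1 hr h) ω.1 ∧
        (ω.2.W1FreeOff (farW w) ∧ ω.2.W2FreeOff (farW w)) := by
  have hB₀ := block42_mem_of_block_mem (B := anyBlockU142) hB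
  obtain ⟨hF, hn, hfc, hnth, hfree, hodd⟩ := ωanyU1_cert
  let ω₀ : ΩG (dom (Dl.map (Face.shiftBy (-refShift w)))) (w42.side .W) (farW w42) :=
    ⟨.W, anyU1Walk.mapDomain fun c hc => hB₀ c hc⟩
  have hF' : ω₀.2.firstHitG = 4 := hF
  have hn' : ω₀.2.arcs.length = 18 := hn
  have h₀ : ω₀.IsB2a := by
    refine ΩG.isB2a_of_forall_fc_ne (by rw [hF', hn']; omega) fun j hj1 hj2 => ?_
    rw [hF'] at hj1
    rw [hn'] at hj2
    exact hfc j hj2 hj1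
  have hM : ω₀.Mv = 14 := by unfold ΩG.Mv; rw [hF', hn']
  exact exists_wound_witness_shift (shiftBy_refShift_root w) (shiftBy_refShift_farW w) hr
    (fun γ r => γ.W1FreeOff r ∧ γ.W2FreeOff r)
    (fun hm _ hf => ⟨YBWalk.W1FreeOff_of_mids_shift hm hf.1, YBWalk.W2FreeOff_of_mids_shift hm hf.2⟩) ω₀ h₀
    (by rw [hF']; exact hnth) hfree (by rw [hM, hF']; exact hodd) θ

/-- The cells of `anyBlockU142` lie in the frame `[0,6]×[−1,5]`, off the hole (decided on the list). [cite: GlazmanManolescu2019, §2.1 (finite domains of faces)] -/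
theorem anyBlockU142_bounds : ∀ a ∈ anyBlockU142, 0 ≤ a.1 ∧ a.1 ≤ 6 ∧ -1 ≤ a.2 ∧ a.2 ≤ 5 ∧ a ≠ (3, 2) := by decide

/-- Any-cell witness block `U2`: the 22 cells of an under wound witness, UNMARKED (one arc per rhombus: `w₁`-free and `w₂`-free off
the far cell), reference root `(4, 2)`, hole `(3, 2)`, far cell `(2, 2)`, inside the frame `[0,6]×[−1,5]`; one of a family whose members have
NO common cell outside the five forced cells (constructive generator `wgen2.py`, seat b-step0 gen 30).
[cite: GlazmanManolescu2019, §2.1 (finite domains of faces)] -/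
def anyBlockU242 : List Face :=
  [(1,-1),(1,0),(1,1),(1,2),(2,-1),(2,1),(2,2),(2,3),(3,-1),(3,1),(3,3),(4,-1),(4,1),(4,2),(4,3),(5,-1),(5,1),(5,2),
  (5,3),(6,-1),(6,0),(6,1)]

/-- Its mid-edges (22 arcs). [cite: GlazmanManolescu2019, §1 (definition of the model), Fig. 1] -/
def anyU2Mids : List MidEdge :=
  [.vert 4 2, .slant 4 2, .vert 4 1, .vert 3 1, .slant 2 2, .slant 2 3, .vert 3 3, .vert 4 3, .vert 5 3, .slant 5 3,
  .slant 5 2, .vert 6 1, .slant 6 1, .slant 6 0, .vert 6 (-1), .vert 5 (-1), .vert 4 (-1), .vert 3 (-1), .vert 2 (-1),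
  .slant 1 0, .slant 1 1, .slant 1 2, .vert 2 2]

/-- The witness as a walk of its block. [cite: GlazmanManolescu2019, §1 (definition of the model), Fig. 1] -/
def anyU2Walk : YBWalk (dom anyBlockU242) (w42.side .W) ((farW w42).side .W) where
  mids := anyU2Mids
  head_eq := by decide
  getLast_eq := by decide
  nodup := by decide
  arc_mem := arc_mem_of_check (by decide)
  isChain := by decide
  noncross := noncross_of_check (by decide)

/-- The labelled witness. [cite: Glazman2015WeightedSAW, Lemma 3.1 (proof, pp. 6–7)] -/
def ωanyU2 : ΩG (dom anyBlockU242) (w42.side .W) (farW w42) := ⟨.W, anyU2Walk⟩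

/-- Certificates: first hit `4`, `22` arcs, no later far-cell arc, first side `S`, `w₁`-free and `w₂`-free off the far
cell, odd eastern-ray count. [cite: Glazman2015WeightedSAW, Lemma 3.1 (proof, pp. 6–7)] [cite: CourantRobbins1958, Ch. V Appendix §2 (the even–odd rule)] -/
theorem ωanyU2_cert : ωanyU2.2.firstHitG = 4 ∧ ωanyU2.2.arcs.length = 22 ∧
    (∀ j < 22, 4 < j → ωanyU2.2.fc j ≠ farW w42) ∧ ωanyU2.2.nth 4 = (farW w42).side .S ∧
    (ωanyU2.2.W1FreeOff (farW w42) ∧ ωanyU2.2.W2FreeOff (farW w42)) ∧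
    Odd ((Finset.range 18).filter fun j => eastRayB w42 (ωanyU2.2.nth (4 + j + 1)) = true).card := by
  refine ⟨by decide, by decide, by decide, by decide, ⟨by unfold YBWalk.W1FreeOff; decide, by unfold YBWalk.W2FreeOff; decide⟩,
    by decide⟩

/-- The block at the root plaquette `w`. [cite: GlazmanManolescu2019, §2.1, §4.2 (translation invariance)] -/
def anyBlockU2 (w : Face) : List Face := anyBlockU242.map (Face.shiftBy (refShift w))

/-- ★★★ The unmarked under wound witness `U2` at EVERY POSITION.
[cite: GlazmanManolescu2019, §4.2 (translation invariance), Lemma 2.1]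
[cite: Glazman2015WeightedSAW, Lemma 3.1 (proof, pp. 6–7)] [cite: CourantRobbins1958, Ch. V Appendix §2 (the even–odd rule)] -/
theorem exists_under_unmarked_of_anyBlockU2 {Dl : List Face} {w : Face} (hB : ∀ c ∈ anyBlockU2 w, c ∈ Dl)
    (hr : RootedFace (dom Dl) (w.side .W) (farW w)) (θ : ℝ) :
    ∃ (ω : ΩG (dom Dl) (w.side .W) (farW w)) (h : ω.IsB2a), ω.2.firstSideG = .S ∧
      ω.WE (fun _ => θ) ≠ excursionWinding θ ω.2.firstSideG (ω.z1 hr h) ω.1 ∧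
        (ω.2.W1FreeOff (farW w) ∧ ω.2.W2FreeOff (farW w)) := by
  have hB₀ := block42_mem_of_block_mem (B := anyBlockU242) hB
  obtain ⟨hF, hn, hfc, hnth, hfree, hodd⟩ := ωanyU2_cert
  let ω₀ : ΩG (dom (Dl.map (Face.shiftBy (-refShift w)))) (w42.side .W) (farW w42) :=
    ⟨.W, anyU2Walk.mapDomain fun c hc => hB₀ c hc⟩
  have hF' : ω₀.2.firstHitG = 4 := hF
  have hn' : ω₀.2.arcs.length = 22 := hn
  have h₀ : ω₀.IsB2a := by
    refine ΩG.isB2a_of_forall_fc_ne (by rw [hF', hn']; omega) fun j hj1 hj2 => ?_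
    rw [hF'] at hj1
    rw [hn'] at hj2
    exact hfc j hj2 hj1
  have hM : ω₀.Mv = 18 := by unfold ΩG.Mv; rw [hF', hn']
  exact exists_wound_witness_shift (shiftBy_refShift_root w) (shiftBy_refShift_farW w) hr
    (fun γ r => γ.W1FreeOff r ∧ γ.W2FreeOff r)
    (fun hm _ hf => ⟨YBWalk.W1FreeOff_of_mids_shift hm hf.1, YBWalk.W2FreeOff_of_mids_shift hm hf.2⟩) ω₀ h₀
    (by rw [hF']; exact hnth) hfree (by rw [hM, hF']; exact hodd) θ

/-- The cells of `anyBlockU242` lie in the frame `[0,6]×[−1,5]`, off the hole (decided on the list). [cite: GlazmanManolescu2019, §2.1 (finite domains of faces)] -/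
theorem anyBlockU242_bounds : ∀ a ∈ anyBlockU242, 0 ≤ a.1 ∧ a.1 ≤ 6 ∧ -1 ≤ a.2 ∧ a.2 ≤ 5 ∧ a ≠ (3, 2) := by decide

/-- Any-cell witness block `U3`: the 20 cells of an under wound witness, UNMARKED (one arc per rhombus: `w₁`-free and `w₂`-free off
the far cell), reference root `(4, 2)`, hole `(3, 2)`, far cell `(2, 2)`, inside the frame `[0,6]×[−1,5]`; one of a family whose members have
NO common cell outside the five forced cells (constructive generator `wgen2.py`, seat b-step0 gen 30).
[cite: GlazmanManolescu2019, §2.1 (finite domains of faces)] -/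
def anyBlockU342 : List Face :=
  [(1,0),(1,1),(1,2),(2,0),(2,1),(2,2),(2,3),(3,0),(3,1),(3,3),(4,0),(4,1),(4,2),(4,3),(5,0),(5,3),(6,0),(6,1),(6,2),
  (6,3)]

/-- Its mid-edges (20 arcs). [cite: GlazmanManolescu2019, §1 (definition of the model), Fig. 1] -/
def anyU3Mids : List MidEdge :=
  [.vert 4 2, .slant 4 2, .vert 4 1, .vert 3 1, .slant 2 2, .slant 2 3, .vert 3 3, .vert 4 3, .vert 5 3, .vert 6 3,
  .slant 6 3, .slant 6 2, .slant 6 1, .vert 6 0, .vert 5 0, .vert 4 0, .vert 3 0, .vert 2 0, .slant 1 1, .slant 1 2,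
  .vert 2 2]

/-- The witness as a walk of its block. [cite: GlazmanManolescu2019, §1 (definition of the model), Fig. 1] -/
def anyU3Walk : YBWalk (dom anyBlockU342) (w42.side .W) ((farW w42).side .W) where
  mids := anyU3Mids
  head_eq := by decide
  getLast_eq := by decide
  nodup := by decide
  arc_mem := arc_mem_of_check (by decide)
  isChain := by decide
  noncross := noncross_of_check (by decide)

/-- The labelled witness. [cite: Glazman2015WeightedSAW, Lemma 3.1 (proof, pp. 6–7)] -/
def ωanyU3 : ΩG (dom anyBlockU342) (w42.side .W) (farW w42) := ⟨.W, anyU3Walk⟩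

/-- Certificates: first hit `4`, `20` arcs, no later far-cell arc, first side `S`, `w₁`-free and `w₂`-free off the far
cell, odd eastern-ray count. [cite: Glazman2015WeightedSAW, Lemma 3.1 (proof, pp. 6–7)] [cite: CourantRobbins1958, Ch. V Appendix §2 (the even–odd rule)] -/
theorem ωanyU3_cert : ωanyU3.2.firstHitG = 4 ∧ ωanyU3.2.arcs.length = 20 ∧
    (∀ j < 20, 4 < j → ωanyU3.2.fc j ≠ farW w42) ∧ ωanyU3.2.nth 4 = (farW w42).side .S ∧
    (ωanyU3.2.W1FreeOff (farW w42) ∧ ωanyU3.2.W2FreeOff (farW w42)) ∧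
    Odd ((Finset.range 16).filter fun j => eastRayB w42 (ωanyU3.2.nth (4 + j + 1)) = true).card := by
  refine ⟨by decide, by decide, by decide, by decide, ⟨by unfold YBWalk.W1FreeOff; decide, by unfold YBWalk.W2FreeOff; decide⟩,
    by decide⟩

/-- The block at the root plaquette `w`. [cite: GlazmanManolescu2019, §2.1, §4.2 (translation invariance)] -/
def anyBlockU3 (w : Face) : List Face := anyBlockU342.map (Face.shiftBy (refShift w))

/-- ★★★ The unmarked under wound witness `U3` at EVERY POSITION.
[cite: GlazmanManolescu2019, §4.2 (translation invariance), Lemma 2.1]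
[cite: Glazman2015WeightedSAW, Lemma 3.1 (proof, pp. 6–7)] [cite: CourantRobbins1958, Ch. V Appendix §2 (the even–odd rule)] -/
theorem exists_under_unmarked_of_anyBlockU3 {Dl : List Face} {w : Face} (hB : ∀ c ∈ anyBlockU3 w, c ∈ Dl)
    (hr : RootedFace (dom Dl) (w.side .W) (farW w)) (θ : ℝ) :
    ∃ (ω : ΩG (dom Dl) (w.side .W) (farW w)) (h : ω.IsB2a), ω.2.firstSideG = .S ∧
      ω.WE (fun _ => θ) ≠ excursionWinding θ ω.2.firstSideG (ω.z1 hr h) ω.1 ∧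
        (ω.2.W1FreeOff (farW w) ∧ ω.2.W2FreeOff (farW w)) := by
  have hB₀ := block42_mem_of_block_mem (B := anyBlockU342) hB
  obtain ⟨hF, hn, hfc, hnth, hfree, hodd⟩ := ωanyU3_cert
  let ω₀ : ΩG (dom (Dl.map (Face.shiftBy (-refShift w)))) (w42.side .W) (farW w42) :=
    ⟨.W, anyU3Walk.mapDomain fun c hc => hB₀ c hc⟩
  have hF' : ω₀.2.firstHitG = 4 := hF
  have hn' : ω₀.2.arcs.length = 20 := hn
  have h₀ : ω₀.IsB2a := by
    refine ΩG.isB2a_of_forall_fc_ne (by rw [hF', hn']; omega) fun j hj1 hj2 => ?_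
    rw [hF'] at hj1
    rw [hn'] at hj2
    exact hfc j hj2 hj1
  have hM : ω₀.Mv = 16 := by unfold ΩG.Mv; rw [hF', hn']
  exact exists_wound_witness_shift (shiftBy_refShift_root w) (shiftBy_refShift_farW w) hr
    (fun γ r => γ.W1FreeOff r ∧ γ.W2FreeOff r)
    (fun hm _ hf => ⟨YBWalk.W1FreeOff_of_mids_shift hm hf.1, YBWalk.W2FreeOff_of_mids_shift hm hf.2⟩) ω₀ h₀
    (by rw [hF']; exact hnth) hfree (by rw [hM, hF']; exact hodd) θ

/-- The cells of `anyBlockU342` lie in the frame `[0,6]×[−1,5]`, off the hole (decided on the list). [cite: GlazmanManolescu2019, §2.1 (finite domains of faces)] -/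
theorem anyBlockU342_bounds : ∀ a ∈ anyBlockU342, 0 ≤ a.1 ∧ a.1 ≤ 6 ∧ -1 ≤ a.2 ∧ a.2 ≤ 5 ∧ a ≠ (3, 2) := by decide

/-- Any-cell witness block `U4`: the 30 cells of an under wound witness, UNMARKED (one arc per rhombus: `w₁`-free and `w₂`-free off
the far cell), reference root `(4, 2)`, hole `(3, 2)`, far cell `(2, 2)`, inside the frame `[0,6]×[−1,5]`; one of a family whose members have
NO common cell outside the five forced cells (constructive generator `wgen2.py`, seat b-step0 gen 30).
[cite: GlazmanManolescu2019, §2.1 (finite domains of faces)] -/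
def anyBlockU442 : List Face :=
  [(0,-1),(0,0),(0,1),(0,2),(1,-1),(1,2),(2,-1),(2,0),(2,1),(2,2),(2,3),(2,4),(3,-1),(3,0),(3,4),(4,-1),(4,0),(4,2),
  (4,4),(5,-1),(5,0),(5,1),(5,2),(5,4),(6,-1),(6,0),(6,1),(6,2),(6,3),(6,4)]

/-- Its mid-edges (30 arcs). [cite: GlazmanManolescu2019, §1 (definition of the model), Fig. 1] -/
def anyU4Mids : List MidEdge :=
  [.vert 4 2, .vert 5 2, .slant 5 2, .slant 5 1, .vert 5 0, .vert 4 0, .vert 3 0, .slant 2 1, .slant 2 2, .slant 2 3,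
  .slant 2 4, .vert 3 4, .vert 4 4, .vert 5 4, .vert 6 4, .slant 6 4, .slant 6 3, .slant 6 2, .slant 6 1, .slant 6 0,
  .vert 6 (-1), .vert 5 (-1), .vert 4 (-1), .vert 3 (-1), .vert 2 (-1), .vert 1 (-1), .slant 0 0, .slant 0 1,
  .slant 0 2, .vert 1 2, .vert 2 2]

/-- The witness as a walk of its block. [cite: GlazmanManolescu2019, §1 (definition of the model), Fig. 1] -/
def anyU4Walk : YBWalk (dom anyBlockU442) (w42.side .W) ((farW w42).side .W) where
  mids := anyU4Mids
  head_eq := by decide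
  getLast_eq := by decide
  nodup := by decide
  arc_mem := arc_mem_of_check (by decide)
  isChain := by decide
  noncross := noncross_of_check (by decide)

/-- The labelled witness. [cite: Glazman2015WeightedSAW, Lemma 3.1 (proof, pp. 6–7)] -/
def ωanyU4 : ΩG (dom anyBlockU442) (w42.side .W) (farW w42) := ⟨.W, anyU4Walk⟩

/-- Certificates: first hit `8`, `30` arcs, no later far-cell arc, first side `S`, `w₁`-free and `w₂`-free off the far
cell, odd eastern-ray count. [cite: Glazman2015WeightedSAW, Lemma 3.1 (proof, pp. 6–7)] [cite: CourantRobbins1958, Ch. V Appendix §2 (the even–odd rule)] -/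
theorem ωanyU4_cert : ωanyU4.2.firstHitG = 8 ∧ ωanyU4.2.arcs.length = 30 ∧
    (∀ j < 30, 8 < j → ωanyU4.2.fc j ≠ farW w42) ∧ ωanyU4.2.nth 8 = (farW w42).side .S ∧
    (ωanyU4.2.W1FreeOff (farW w42) ∧ ωanyU4.2.W2FreeOff (farW w42)) ∧
    Odd ((Finset.range 22).filter fun j => eastRayB w42 (ωanyU4.2.nth (8 + j + 1)) = true).card := by
  refine ⟨by decide, by decide, by decide, by decide, ⟨by unfold YBWalk.W1FreeOff; decide, by unfold YBWalk.W2FreeOff; decide⟩,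
    by decide⟩

/-- The block at the root plaquette `w`. [cite: GlazmanManolescu2019, §2.1, §4.2 (translation invariance)] -/
def anyBlockU4 (w : Face) : List Face := anyBlockU442.map (Face.shiftBy (refShift w))

/-- ★★★ The unmarked under wound witness `U4` at EVERY POSITION.
[cite: GlazmanManolescu2019, §4.2 (translation invariance), Lemma 2.1]
[cite: Glazman2015WeightedSAW, Lemma 3.1 (proof, pp. 6–7)] [cite: CourantRobbins1958, Ch. V Appendix §2 (the even–odd rule)] -/
theorem exists_under_unmarked_of_anyBlockU4 {Dl : List Face} {w : Face} (hB : ∀ c ∈ anyBlockU4 w, c ∈ Dl)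
    (hr : RootedFace (dom Dl) (w.side .W) (farW w)) (θ : ℝ) :
    ∃ (ω : ΩG (dom Dl) (w.side .W) (farW w)) (h : ω.IsB2a), ω.2.firstSideG = .S ∧
      ω.WE (fun _ => θ) ≠ excursionWinding θ ω.2.firstSideG (ω.z1 hr h) ω.1 ∧
        (ω.2.W1FreeOff (farW w) ∧ ω.2.W2FreeOff (farW w)) := by
  have hB₀ := block42_mem_of_block_mem (B := anyBlockU442) hB
  obtain ⟨hF, hn, hfc, hnth, hfree, hodd⟩ := ωanyU4_cert
  let ω₀ : ΩG (dom (Dl.map (Face.shiftBy (-refShift w)))) (w42.side .W) (farW w42) :=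
    ⟨.W, anyU4Walk.mapDomain fun c hc => hB₀ c hc⟩
  have hF' : ω₀.2.firstHitG = 8 := hF
  have hn' : ω₀.2.arcs.length = 30 := hn
  have h₀ : ω₀.IsB2a := by
    refine ΩG.isB2a_of_forall_fc_ne (by rw [hF', hn']; omega) fun j hj1 hj2 => ?_
    rw [hF'] at hj1
    rw [hn'] at hj2
    exact hfc j hj2 hj1
  have hM : ω₀.Mv = 22 := by unfold ΩG.Mv; rw [hF', hn']
  exact exists_wound_witness_shift (shiftBy_refShift_root w) (shiftBy_refShift_farW w) hr
    (fun γ r => γ.W1FreeOff r ∧ γ.W2FreeOff r)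
    (fun hm _ hf => ⟨YBWalk.W1FreeOff_of_mids_shift hm hf.1, YBWalk.W2FreeOff_of_mids_shift hm hf.2⟩) ω₀ h₀
    (by rw [hF']; exact hnth) hfree (by rw [hM, hF']; exact hodd) θ

/-- The cells of `anyBlockU442` lie in the frame `[0,6]×[−1,5]`, off the hole (decided on the list). [cite: GlazmanManolescu2019, §2.1 (finite domains of faces)] -/
theorem anyBlockU442_bounds : ∀ a ∈ anyBlockU442, 0 ≤ a.1 ∧ a.1 ≤ 6 ∧ -1 ≤ a.2 ∧ a.2 ≤ 5 ∧ a ≠ (3, 2) := by decide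

/-- Any-cell witness block `O1`: the 18 cells of an over wound witness, UNMARKED (one arc per rhombus: `w₁`-free and `w₂`-free off
the far cell), reference root `(4, 2)`, hole `(3, 2)`, far cell `(2, 2)`, inside the frame `[0,6]×[−1,5]`; one of a family whose members have
NO common cell outside the five forced cells (constructive generator `wgen2.py`, seat b-step0 gen 30).
[cite: GlazmanManolescu2019, §2.1 (finite domains of faces)] -/
def anyBlockO142 : List Face :=
  [(1,2),(1,3),(1,4),(2,1),(2,2),(2,3),(2,4),(3,1),(3,3),(3,4),(4,1),(4,2),(4,3),(4,4),(5,1),(5,2),(5,3),(5,4)]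

/-- Its mid-edges (18 arcs). [cite: GlazmanManolescu2019, §1 (definition of the model), Fig. 1] -/
def anyO1Mids : List MidEdge :=
  [.vert 4 2, .slant 4 3, .vert 4 3, .vert 3 3, .slant 2 3, .vert 2 2, .slant 1 3, .slant 1 4, .vert 2 4, .vert 3 4,
  .vert 4 4, .vert 5 4, .slant 5 4, .slant 5 3, .slant 5 2, .vert 5 1, .vert 4 1, .vert 3 1, .slant 2 2]

/-- The witness as a walk of its block. [cite: GlazmanManolescu2019, §1 (definition of the model), Fig. 1] -/
def anyO1Walk : YBWalk (dom anyBlockO142) (w42.side .W) ((farW w42).side .S) where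
  mids := anyO1Mids
  head_eq := by decide
  getLast_eq := by decide
  nodup := by decide
  arc_mem := arc_mem_of_check (by decide)
  isChain := by decide
  noncross := noncross_of_check (by decide)

/-- The labelled witness. [cite: Glazman2015WeightedSAW, Lemma 3.1 (proof, pp. 6–7)] -/
def ωanyO1 : ΩG (dom anyBlockO142) (w42.side .W) (farW w42) := ⟨.S, anyO1Walk⟩

/-- Certificates: first hit `4`, `18` arcs, no later far-cell arc, first side `N`, `w₁`-free and `w₂`-free off the far
cell, odd eastern-ray count. [cite: Glazman2015WeightedSAW, Lemma 3.1 (proof, pp. 6–7)] [cite: CourantRobbins1958, Ch. V Appendix §2 (the even–odd rule)] -/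
theorem ωanyO1_cert : ωanyO1.2.firstHitG = 4 ∧ ωanyO1.2.arcs.length = 18 ∧
    (∀ j < 18, 4 < j → ωanyO1.2.fc j ≠ farW w42) ∧ ωanyO1.2.nth 4 = (farW w42).side .N ∧
    (ωanyO1.2.W1FreeOff (farW w42) ∧ ωanyO1.2.W2FreeOff (farW w42)) ∧
    Odd ((Finset.range 14).filter fun j => eastRayB w42 (ωanyO1.2.nth (4 + j + 1)) = true).card := by
  refine ⟨by decide, by decide, by decide, by decide, ⟨by unfold YBWalk.W1FreeOff; decide, by unfold YBWalk.W2FreeOff; decide⟩,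
    by decide⟩

/-- The block at the root plaquette `w`. [cite: GlazmanManolescu2019, §2.1, §4.2 (translation invariance)] -/
def anyBlockO1 (w : Face) : List Face := anyBlockO142.map (Face.shiftBy (refShift w))

/-- ★★★ The unmarked over wound witness `O1` at EVERY POSITION.
[cite: GlazmanManolescu2019, §4.2 (translation invariance), Lemma 2.1]
[cite: Glazman2015WeightedSAW, Lemma 3.1 (proof, pp. 6–7)] [cite: CourantRobbins1958, Ch. V Appendix §2 (the even–odd rule)] -/
theorem exists_over_unmarked_of_anyBlockO1 {Dl : List Face} {w : Face} (hB : ∀ c ∈ anyBlockO1 w, c ∈ Dl)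
    (hr : RootedFace (dom Dl) (w.side .W) (farW w)) (θ : ℝ) :
    ∃ (ω : ΩG (dom Dl) (w.side .W) (farW w)) (h : ω.IsB2a), ω.2.firstSideG = .N ∧
      ω.WE (fun _ => θ) ≠ excursionWinding θ ω.2.firstSideG (ω.z1 hr h) ω.1 ∧
        (ω.2.W1FreeOff (farW w) ∧ ω.2.W2FreeOff (farW w)) := by
  have hB₀ := block42_mem_of_block_mem (B := anyBlockO142) hB
  obtain ⟨hF, hn, hfc, hnth, hfree, hodd⟩ := ωanyO1_cert
  let ω₀ : ΩG (dom (Dl.map (Face.shiftBy (-refShift w)))) (w42.side .W) (farW w42) :=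
    ⟨.S, anyO1Walk.mapDomain fun c hc => hB₀ c hc⟩
  have hF' : ω₀.2.firstHitG = 4 := hF
  have hn' : ω₀.2.arcs.length = 18 := hn
  have h₀ : ω₀.IsB2a := by
    refine ΩG.isB2a_of_forall_fc_ne (by rw [hF', hn']; omega) fun j hj1 hj2 => ?_
    rw [hF'] at hj1
    rw [hn'] at hj2
    exact hfc j hj2 hj1
  have hM : ω₀.Mv = 14 := by unfold ΩG.Mv; rw [hF', hn']
  exact exists_wound_witness_shift (shiftBy_refShift_root w) (shiftBy_refShift_farW w) hr
    (fun γ r => γ.W1FreeOff r ∧ γ.W2FreeOff r)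
    (fun hm _ hf => ⟨YBWalk.W1FreeOff_of_mids_shift hm hf.1, YBWalk.W2FreeOff_of_mids_shift hm hf.2⟩) ω₀ h₀
    (by rw [hF']; exact hnth) hfree (by rw [hM, hF']; exact hodd) θ

/-- The cells of `anyBlockO142` lie in the frame `[0,6]×[−1,5]`, off the hole (decided on the list). [cite: GlazmanManolescu2019, §2.1 (finite domains of faces)] -/
theorem anyBlockO142_bounds : ∀ a ∈ anyBlockO142, 0 ≤ a.1 ∧ a.1 ≤ 6 ∧ -1 ≤ a.2 ∧ a.2 ≤ 5 ∧ a ≠ (3, 2) := by decide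

/-- Any-cell witness block `O2`: the 22 cells of an over wound witness, UNMARKED (one arc per rhombus: `w₁`-free and `w₂`-free off
the far cell), reference root `(4, 2)`, hole `(3, 2)`, far cell `(2, 2)`, inside the frame `[0,6]×[−1,5]`; one of a family whose members have
NO common cell outside the five forced cells (constructive generator `wgen2.py`, seat b-step0 gen 30).
[cite: GlazmanManolescu2019, §2.1 (finite domains of faces)] -/
def anyBlockO242 : List Face :=
  [(1,2),(1,3),(1,4),(2,0),(2,1),(2,2),(2,3),(2,4),(3,0),(3,3),(3,4),(4,0),(4,2),(4,3),(4,4),(5,0),(5,4),(6,0),(6,1),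
  (6,2),(6,3),(6,4)]

/-- Its mid-edges (22 arcs). [cite: GlazmanManolescu2019, §1 (definition of the model), Fig. 1] -/
def anyO2Mids : List MidEdge :=
  [.vert 4 2, .slant 4 3, .vert 4 3, .vert 3 3, .slant 2 3, .vert 2 2, .slant 1 3, .slant 1 4, .vert 2 4, .vert 3 4,
  .vert 4 4, .vert 5 4, .vert 6 4, .slant 6 4, .slant 6 3, .slant 6 2, .slant 6 1, .vert 6 0, .vert 5 0, .vert 4 0,
  .vert 3 0, .slant 2 1, .slant 2 2]

/-- The witness as a walk of its block. [cite: GlazmanManolescu2019, §1 (definition of the model), Fig. 1] -/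
def anyO2Walk : YBWalk (dom anyBlockO242) (w42.side .W) ((farW w42).side .S) where
  mids := anyO2Mids
  head_eq := by decide
  getLast_eq := by decide
  nodup := by decide
  arc_mem := arc_mem_of_check (by decide)
  isChain := by decide
  noncross := noncross_of_check (by decide)

/-- The labelled witness. [cite: Glazman2015WeightedSAW, Lemma 3.1 (proof, pp. 6–7)] -/
def ωanyO2 : ΩG (dom anyBlockO242) (w42.side .W) (farW w42) := ⟨.S, anyO2Walk⟩

/-- Certificates: first hit `4`, `22` arcs, no later far-cell arc, first side `N`, `w₁`-free and `w₂`-free off the far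
cell, odd eastern-ray count. [cite: Glazman2015WeightedSAW, Lemma 3.1 (proof, pp. 6–7)] [cite: CourantRobbins1958, Ch. V Appendix §2 (the even–odd rule)] -/
theorem ωanyO2_cert : ωanyO2.2.firstHitG = 4 ∧ ωanyO2.2.arcs.length = 22 ∧
    (∀ j < 22, 4 < j → ωanyO2.2.fc j ≠ farW w42) ∧ ωanyO2.2.nth 4 = (farW w42).side .N ∧
    (ωanyO2.2.W1FreeOff (farW w42) ∧ ωanyO2.2.W2FreeOff (farW w42)) ∧
    Odd ((Finset.range 18).filter fun j => eastRayB w42 (ωanyO2.2.nth (4 + j + 1)) = true).card := by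
  refine ⟨by decide, by decide, by decide, by decide, ⟨by unfold YBWalk.W1FreeOff; decide, by unfold YBWalk.W2FreeOff; decide⟩,
    by decide⟩

/-- The block at the root plaquette `w`. [cite: GlazmanManolescu2019, §2.1, §4.2 (translation invariance)] -/
def anyBlockO2 (w : Face) : List Face := anyBlockO242.map (Face.shiftBy (refShift w))

/-- ★★★ The unmarked over wound witness `O2` at EVERY POSITION.
[cite: GlazmanManolescu2019, §4.2 (translation invariance), Lemma 2.1]
[cite: Glazman2015WeightedSAW, Lemma 3.1 (proof, pp. 6–7)] [cite: CourantRobbins1958, Ch. V Appendix §2 (the even–odd rule)] -/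
theorem exists_over_unmarked_of_anyBlockO2 {Dl : List Face} {w : Face} (hB : ∀ c ∈ anyBlockO2 w, c ∈ Dl)
    (hr : RootedFace (dom Dl) (w.side .W) (farW w)) (θ : ℝ) :
    ∃ (ω : ΩG (dom Dl) (w.side .W) (farW w)) (h : ω.IsB2a), ω.2.firstSideG = .N ∧
      ω.WE (fun _ => θ) ≠ excursionWinding θ ω.2.firstSideG (ω.z1 hr h) ω.1 ∧
        (ω.2.W1FreeOff (farW w) ∧ ω.2.W2FreeOff (farW w)) := by
  have hB₀ := block42_mem_of_block_mem (B := anyBlockO242) hB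
  obtain ⟨hF, hn, hfc, hnth, hfree, hodd⟩ := ωanyO2_cert
  let ω₀ : ΩG (dom (Dl.map (Face.shiftBy (-refShift w)))) (w42.side .W) (farW w42) :=
    ⟨.S, anyO2Walk.mapDomain fun c hc => hB₀ c hc⟩
  have hF' : ω₀.2.firstHitG = 4 := hF
  have hn' : ω₀.2.arcs.length = 22 := hn
  have h₀ : ω₀.IsB2a := by
    refine ΩG.isB2a_of_forall_fc_ne (by rw [hF', hn']; omega) fun j hj1 hj2 => ?_
    rw [hF'] at hj1
    rw [hn'] at hj2
    exact hfc j hj2 hj1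
  have hM : ω₀.Mv = 18 := by unfold ΩG.Mv; rw [hF', hn']
  exact exists_wound_witness_shift (shiftBy_refShift_root w) (shiftBy_refShift_farW w) hr
    (fun γ r => γ.W1FreeOff r ∧ γ.W2FreeOff r)
    (fun hm _ hf => ⟨YBWalk.W1FreeOff_of_mids_shift hm hf.1, YBWalk.W2FreeOff_of_mids_shift hm hf.2⟩) ω₀ h₀
    (by rw [hF']; exact hnth) hfree (by rw [hM, hF']; exact hodd) θ

/-- The cells of `anyBlockO242` lie in the frame `[0,6]×[−1,5]`, off the hole (decided on the list). [cite: GlazmanManolescu2019, §2.1 (finite domains of faces)] -/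
theorem anyBlockO242_bounds : ∀ a ∈ anyBlockO242, 0 ≤ a.1 ∧ a.1 ≤ 6 ∧ -1 ≤ a.2 ∧ a.2 ≤ 5 ∧ a ≠ (3, 2) := by decide

/-- Any-cell witness block `O3`: the 22 cells of an over wound witness, UNMARKED (one arc per rhombus: `w₁`-free and `w₂`-free off
the far cell), reference root `(4, 2)`, hole `(3, 2)`, far cell `(2, 2)`, inside the frame `[0,6]×[−1,5]`; one of a family whose members have
NO common cell outside the five forced cells (constructive generator `wgen2.py`, seat b-step0 gen 30).
[cite: GlazmanManolescu2019, §2.1 (finite domains of faces)] -/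
def anyBlockO342 : List Face :=
  [(0,2),(0,3),(0,4),(0,5),(1,2),(1,5),(2,1),(2,2),(2,3),(2,5),(3,1),(3,3),(3,5),(4,1),(4,2),(4,3),(4,5),(5,1),(5,2),
  (5,3),(5,4),(5,5)]

/-- Its mid-edges (22 arcs). [cite: GlazmanManolescu2019, §1 (definition of the model), Fig. 1] -/
def anyO3Mids : List MidEdge :=
  [.vert 4 2, .slant 4 3, .vert 4 3, .vert 3 3, .slant 2 3, .vert 2 2, .vert 1 2, .slant 0 3, .slant 0 4, .slant 0 5,
  .vert 1 5, .vert 2 5, .vert 3 5, .vert 4 5, .vert 5 5, .slant 5 5, .slant 5 4, .slant 5 3, .slant 5 2, .vert 5 1,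
  .vert 4 1, .vert 3 1, .slant 2 2]

/-- The witness as a walk of its block. [cite: GlazmanManolescu2019, §1 (definition of the model), Fig. 1] -/
def anyO3Walk : YBWalk (dom anyBlockO342) (w42.side .W) ((farW w42).side .S) where
  mids := anyO3Mids
  head_eq := by decide
  getLast_eq := by decide
  nodup := by decide
  arc_mem := arc_mem_of_check (by decide)
  isChain := by decide
  noncross := noncross_of_check (by decide)

/-- The labelled witness. [cite: Glazman2015WeightedSAW, Lemma 3.1 (proof, pp. 6–7)] -/
def ωanyO3 : ΩG (dom anyBlockO342) (w42.side .W) (farW w42) := ⟨.S, anyO3Walk⟩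

/-- Certificates: first hit `4`, `22` arcs, no later far-cell arc, first side `N`, `w₁`-free and `w₂`-free off the far
cell, odd eastern-ray count. [cite: Glazman2015WeightedSAW, Lemma 3.1 (proof, pp. 6–7)] [cite: CourantRobbins1958, Ch. V Appendix §2 (the even–odd rule)] -/
theorem ωanyO3_cert : ωanyO3.2.firstHitG = 4 ∧ ωanyO3.2.arcs.length = 22 ∧
    (∀ j < 22, 4 < j → ωanyO3.2.fc j ≠ farW w42) ∧ ωanyO3.2.nth 4 = (farW w42).side .N ∧
    (ωanyO3.2.W1FreeOff (farW w42) ∧ ωanyO3.2.W2FreeOff (farW w42)) ∧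
    Odd ((Finset.range 18).filter fun j => eastRayB w42 (ωanyO3.2.nth (4 + j + 1)) = true).card := by
  refine ⟨by decide, by decide, by decide, by decide, ⟨by unfold YBWalk.W1FreeOff; decide, by unfold YBWalk.W2FreeOff; decide⟩,
    by decide⟩

/-- The block at the root plaquette `w`. [cite: GlazmanManolescu2019, §2.1, §4.2 (translation invariance)] -/
def anyBlockO3 (w : Face) : List Face := anyBlockO342.map (Face.shiftBy (refShift w))

/-- ★★★ The unmarked over wound witness `O3` at EVERY POSITION.
[cite: GlazmanManolescu2019, §4.2 (translation invariance), Lemma 2.1]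
[cite: Glazman2015WeightedSAW, Lemma 3.1 (proof, pp. 6–7)] [cite: CourantRobbins1958, Ch. V Appendix §2 (the even–odd rule)] -/
theorem exists_over_unmarked_of_anyBlockO3 {Dl : List Face} {w : Face} (hB : ∀ c ∈ anyBlockO3 w, c ∈ Dl)
    (hr : RootedFace (dom Dl) (w.side .W) (farW w)) (θ : ℝ) :
    ∃ (ω : ΩG (dom Dl) (w.side .W) (farW w)) (h : ω.IsB2a), ω.2.firstSideG = .N ∧
      ω.WE (fun _ => θ) ≠ excursionWinding θ ω.2.firstSideG (ω.z1 hr h) ω.1 ∧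
        (ω.2.W1FreeOff (farW w) ∧ ω.2.W2FreeOff (farW w)) := by
  have hB₀ := block42_mem_of_block_mem (B := anyBlockO342) hB
  obtain ⟨hF, hn, hfc, hnth, hfree, hodd⟩ := ωanyO3_cert
  let ω₀ : ΩG (dom (Dl.map (Face.shiftBy (-refShift w)))) (w42.side .W) (farW w42) :=
    ⟨.S, anyO3Walk.mapDomain fun c hc => hB₀ c hc⟩
  have hF' : ω₀.2.firstHitG = 4 := hF
  have hn' : ω₀.2.arcs.length = 22 := hn
  have h₀ : ω₀.IsB2a := by
    refine ΩG.isB2a_of_forall_fc_ne (by rw [hF', hn']; omega) fun j hj1 hj2 => ?_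
    rw [hF'] at hj1
    rw [hn'] at hj2
    exact hfc j hj2 hj1
  have hM : ω₀.Mv = 18 := by unfold ΩG.Mv; rw [hF', hn']
  exact exists_wound_witness_shift (shiftBy_refShift_root w) (shiftBy_refShift_farW w) hr
    (fun γ r => γ.W1FreeOff r ∧ γ.W2FreeOff r)
    (fun hm _ hf => ⟨YBWalk.W1FreeOff_of_mids_shift hm hf.1, YBWalk.W2FreeOff_of_mids_shift hm hf.2⟩) ω₀ h₀
    (by rw [hF']; exact hnth) hfree (by rw [hM, hF']; exact hodd) θ

/-- The cells of `anyBlockO342` lie in the frame `[0,6]×[−1,5]`, off the hole (decided on the list). [cite: GlazmanManolescu2019, §2.1 (finite domains of faces)] -/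
theorem anyBlockO342_bounds : ∀ a ∈ anyBlockO342, 0 ≤ a.1 ∧ a.1 ≤ 6 ∧ -1 ≤ a.2 ∧ a.2 ≤ 5 ∧ a ≠ (3, 2) := by decide

/-- Any-cell witness block `O4`: the 26 cells of an over wound witness, UNMARKED (one arc per rhombus: `w₁`-free and `w₂`-free off
the far cell), reference root `(4, 2)`, hole `(3, 2)`, far cell `(2, 2)`, inside the frame `[0,6]×[−1,5]`; one of a family whose members have
NO common cell outside the five forced cells (constructive generator `wgen2.py`, seat b-step0 gen 30).
[cite: GlazmanManolescu2019, §2.1 (finite domains of faces)] -/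
def anyBlockO442 : List Face :=
  [(1,2),(1,3),(1,4),(1,5),(2,1),(2,2),(2,3),(2,4),(2,5),(3,1),(3,4),(3,5),(4,1),(4,2),(4,4),(4,5),(5,1),(5,2),(5,3),
  (5,4),(5,5),(6,1),(6,2),(6,3),(6,4),(6,5)]

/-- Its mid-edges (26 arcs). [cite: GlazmanManolescu2019, §1 (definition of the model), Fig. 1] -/
def anyO4Mids : List MidEdge :=
  [.vert 4 2, .vert 5 2, .slant 5 3, .slant 5 4, .vert 5 4, .vert 4 4, .vert 3 4, .slant 2 4, .slant 2 3, .vert 2 2,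
  .slant 1 3, .slant 1 4, .slant 1 5, .vert 2 5, .vert 3 5, .vert 4 5, .vert 5 5, .vert 6 5, .slant 6 5, .slant 6 4,
  .slant 6 3, .slant 6 2, .vert 6 1, .vert 5 1, .vert 4 1, .vert 3 1, .slant 2 2]

/-- The witness as a walk of its block. [cite: GlazmanManolescu2019, §1 (definition of the model), Fig. 1] -/
def anyO4Walk : YBWalk (dom anyBlockO442) (w42.side .W) ((farW w42).side .S) where
  mids := anyO4Mids
  head_eq := by decide
  getLast_eq := by decide
  nodup := by decide
  arc_mem := arc_mem_of_check (by decide)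
  isChain := by decide
  noncross := noncross_of_check (by decide)

/-- The labelled witness. [cite: Glazman2015WeightedSAW, Lemma 3.1 (proof, pp. 6–7)] -/
def ωanyO4 : ΩG (dom anyBlockO442) (w42.side .W) (farW w42) := ⟨.S, anyO4Walk⟩

/-- Certificates: first hit `8`, `26` arcs, no later far-cell arc, first side `N`, `w₁`-free and `w₂`-free off the far
cell, odd eastern-ray count. [cite: Glazman2015WeightedSAW, Lemma 3.1 (proof, pp. 6–7)] [cite: CourantRobbins1958, Ch. V Appendix §2 (the even–odd rule)] -/
theorem ωanyO4_cert : ωanyO4.2.firstHitG = 8 ∧ ωanyO4.2.arcs.length = 26 ∧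
    (∀ j < 26, 8 < j → ωanyO4.2.fc j ≠ farW w42) ∧ ωanyO4.2.nth 8 = (farW w42).side .N ∧
    (ωanyO4.2.W1FreeOff (farW w42) ∧ ωanyO4.2.W2FreeOff (farW w42)) ∧
    Odd ((Finset.range 18).filter fun j => eastRayB w42 (ωanyO4.2.nth (8 + j + 1)) = true).card := by
  refine ⟨by decide, by decide, by decide, by decide, ⟨by unfold YBWalk.W1FreeOff; decide, by unfold YBWalk.W2FreeOff; decide⟩,
    by decide⟩

/-- The block at the root plaquette `w`. [cite: GlazmanManolescu2019, §2.1, §4.2 (translation invariance)] -/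
def anyBlockO4 (w : Face) : List Face := anyBlockO442.map (Face.shiftBy (refShift w))

/-- ★★★ The unmarked over wound witness `O4` at EVERY POSITION.
[cite: GlazmanManolescu2019, §4.2 (translation invariance), Lemma 2.1]
[cite: Glazman2015WeightedSAW, Lemma 3.1 (proof, pp. 6–7)] [cite: CourantRobbins1958, Ch. V Appendix §2 (the even–odd rule)] -/
theorem exists_over_unmarked_of_anyBlockO4 {Dl : List Face} {w : Face} (hB : ∀ c ∈ anyBlockO4 w, c ∈ Dl)
    (hr : RootedFace (dom Dl) (w.side .W) (farW w)) (θ : ℝ) :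
    ∃ (ω : ΩG (dom Dl) (w.side .W) (farW w)) (h : ω.IsB2a), ω.2.firstSideG = .N ∧
      ω.WE (fun _ => θ) ≠ excursionWinding θ ω.2.firstSideG (ω.z1 hr h) ω.1 ∧
        (ω.2.W1FreeOff (farW w) ∧ ω.2.W2FreeOff (farW w)) := by
  have hB₀ := block42_mem_of_block_mem (B := anyBlockO442) hB
  obtain ⟨hF, hn, hfc, hnth, hfree, hodd⟩ := ωanyO4_cert
  let ω₀ : ΩG (dom (Dl.map (Face.shiftBy (-refShift w)))) (w42.side .W) (farW w42) :=
    ⟨.S, anyO4Walk.mapDomain fun c hc => hB₀ c hc⟩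
  have hF' : ω₀.2.firstHitG = 8 := hF
  have hn' : ω₀.2.arcs.length = 26 := hn
  have h₀ : ω₀.IsB2a := by
    refine ΩG.isB2a_of_forall_fc_ne (by rw [hF', hn']; omega) fun j hj1 hj2 => ?_
    rw [hF'] at hj1
    rw [hn'] at hj2
    exact hfc j hj2 hj1
  have hM : ω₀.Mv = 18 := by unfold ΩG.Mv; rw [hF', hn']
  exact exists_wound_witness_shift (shiftBy_refShift_root w) (shiftBy_refShift_farW w) hr
    (fun γ r => γ.W1FreeOff r ∧ γ.W2FreeOff r)
    (fun hm _ hf => ⟨YBWalk.W1FreeOff_of_mids_shift hm hf.1, YBWalk.W2FreeOff_of_mids_shift hm hf.2⟩) ω₀ h₀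
    (by rw [hF']; exact hnth) hfree (by rw [hM, hF']; exact hodd) θ

/-- The cells of `anyBlockO442` lie in the frame `[0,6]×[−1,5]`, off the hole (decided on the list). [cite: GlazmanManolescu2019, §2.1 (finite domains of faces)] -/
theorem anyBlockO442_bounds : ∀ a ∈ anyBlockO442, 0 ≤ a.1 ∧ a.1 ≤ 6 ∧ -1 ≤ a.2 ∧ a.2 ≤ 5 ∧ a ≠ (3, 2) := by decide

/-- Any-cell witness block `O5`: the 22 cells of an over wound witness, UNMARKED (one arc per rhombus: `w₁`-free and `w₂`-free off
the far cell), reference root `(4, 2)`, hole `(3, 2)`, far cell `(2, 2)`, inside the frame `[0,6]×[−1,5]`; one of a family whose members have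
NO common cell outside the five forced cells (constructive generator `wgen2.py`, seat b-step0 gen 30).
[cite: GlazmanManolescu2019, §2.1 (finite domains of faces)] -/
def anyBlockO542 : List Face :=
  [(1,2),(1,3),(1,4),(2,1),(2,2),(2,3),(2,4),(3,1),(3,3),(3,4),(4,1),(4,2),(4,3),(4,4),(4,5),(5,1),(5,2),(5,3),(5,5),
  (6,3),(6,4),(6,5)]

/-- Its mid-edges (22 arcs). [cite: GlazmanManolescu2019, §1 (definition of the model), Fig. 1] -/
def anyO5Mids : List MidEdge :=
  [.vert 4 2, .slant 4 3, .vert 4 3, .vert 3 3, .slant 2 3, .vert 2 2, .slant 1 3, .slant 1 4, .vert 2 4, .vert 3 4,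
  .vert 4 4, .slant 4 5, .vert 5 5, .vert 6 5, .slant 6 5, .slant 6 4, .vert 6 3, .slant 5 3, .slant 5 2, .vert 5 1,
  .vert 4 1, .vert 3 1, .slant 2 2]

/-- The witness as a walk of its block. [cite: GlazmanManolescu2019, §1 (definition of the model), Fig. 1] -/
def anyO5Walk : YBWalk (dom anyBlockO542) (w42.side .W) ((farW w42).side .S) where
  mids := anyO5Mids
  head_eq := by decide
  getLast_eq := by decide
  nodup := by decide
  arc_mem := arc_mem_of_check (by decide)
  isChain := by decide
  noncross := noncross_of_check (by decide)

/-- The labelled witness. [cite: Glazman2015WeightedSAW, Lemma 3.1 (proof, pp. 6–7)] -/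
def ωanyO5 : ΩG (dom anyBlockO542) (w42.side .W) (farW w42) := ⟨.S, anyO5Walk⟩

/-- Certificates: first hit `4`, `22` arcs, no later far-cell arc, first side `N`, `w₁`-free and `w₂`-free off the far
cell, odd eastern-ray count. [cite: Glazman2015WeightedSAW, Lemma 3.1 (proof, pp. 6–7)] [cite: CourantRobbins1958, Ch. V Appendix §2 (the even–odd rule)] -/
theorem ωanyO5_cert : ωanyO5.2.firstHitG = 4 ∧ ωanyO5.2.arcs.length = 22 ∧
    (∀ j < 22, 4 < j → ωanyO5.2.fc j ≠ farW w42) ∧ ωanyO5.2.nth 4 = (farW w42).side .N ∧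
    (ωanyO5.2.W1FreeOff (farW w42) ∧ ωanyO5.2.W2FreeOff (farW w42)) ∧
    Odd ((Finset.range 18).filter fun j => eastRayB w42 (ωanyO5.2.nth (4 + j + 1)) = true).card := by
  refine ⟨by decide, by decide, by decide, by decide, ⟨by unfold YBWalk.W1FreeOff; decide, by unfold YBWalk.W2FreeOff; decide⟩,
    by decide⟩

/-- The block at the root plaquette `w`. [cite: GlazmanManolescu2019, §2.1, §4.2 (translation invariance)] -/
def anyBlockO5 (w : Face) : List Face := anyBlockO542.map (Face.shiftBy (refShift w))

/-- ★★★ The unmarked over wound witness `O5` at EVERY POSITION.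
[cite: GlazmanManolescu2019, §4.2 (translation invariance), Lemma 2.1]
[cite: Glazman2015WeightedSAW, Lemma 3.1 (proof, pp. 6–7)] [cite: CourantRobbins1958, Ch. V Appendix §2 (the even–odd rule)] -/
theorem exists_over_unmarked_of_anyBlockO5 {Dl : List Face} {w : Face} (hB : ∀ c ∈ anyBlockO5 w, c ∈ Dl)
    (hr : RootedFace (dom Dl) (w.side .W) (farW w)) (θ : ℝ) :
    ∃ (ω : ΩG (dom Dl) (w.side .W) (farW w)) (h : ω.IsB2a), ω.2.firstSideG = .N ∧
      ω.WE (fun _ => θ) ≠ excursionWinding θ ω.2.firstSideG (ω.z1 hr h) ω.1 ∧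
        (ω.2.W1FreeOff (farW w) ∧ ω.2.W2FreeOff (farW w)) := by
  have hB₀ := block42_mem_of_block_mem (B := anyBlockO542) hB
  obtain ⟨hF, hn, hfc, hnth, hfree, hodd⟩ := ωanyO5_cert
  let ω₀ : ΩG (dom (Dl.map (Face.shiftBy (-refShift w)))) (w42.side .W) (farW w42) :=
    ⟨.S, anyO5Walk.mapDomain fun c hc => hB₀ c hc⟩
  have hF' : ω₀.2.firstHitG = 4 := hF
  have hn' : ω₀.2.arcs.length = 22 := hn
  have h₀ : ω₀.IsB2a := by
    refine ΩG.isB2a_of_forall_fc_ne (by rw [hF', hn']; omega) fun j hj1 hj2 => ?_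
    rw [hF'] at hj1
    rw [hn'] at hj2
    exact hfc j hj2 hj1
  have hM : ω₀.Mv = 18 := by unfold ΩG.Mv; rw [hF', hn']
  exact exists_wound_witness_shift (shiftBy_refShift_root w) (shiftBy_refShift_farW w) hr
    (fun γ r => γ.W1FreeOff r ∧ γ.W2FreeOff r)
    (fun hm _ hf => ⟨YBWalk.W1FreeOff_of_mids_shift hm hf.1, YBWalk.W2FreeOff_of_mids_shift hm hf.2⟩) ω₀ h₀
    (by rw [hF']; exact hnth) hfree (by rw [hM, hF']; exact hodd) θ

/-- The cells of `anyBlockO542` lie in the frame `[0,6]×[−1,5]`, off the hole (decided on the list). [cite: GlazmanManolescu2019, §2.1 (finite domains of faces)] -/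
theorem anyBlockO542_bounds : ∀ a ∈ anyBlockO542, 0 ≤ a.1 ∧ a.1 ≤ 6 ∧ -1 ≤ a.2 ∧ a.2 ≤ 5 ∧ a ≠ (3, 2) := by decide

/-- ★ UNDER COVER: a cell common to all four under blocks is a forced cell (root plaquette, far cell, or a far door).
[cite: GlazmanManolescu2019, §2.1 (finite domains of faces)] -/
theorem anyCell_under_cover : ∀ a ∈ anyBlockU142, a ∈ anyBlockU242 → a ∈ anyBlockU342 → a ∈ anyBlockU442 →
    a = (4, 2) ∨ a = (2, 2) ∨ a = (2, 1) ∨ a = (2, 3) ∨ a = (1, 2) := by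
  decide

/-- ★ OVER COVER: a cell common to all five over blocks is a forced cell. [cite: GlazmanManolescu2019, §2.1 (finite domains of faces)] -/
theorem anyCell_over_cover : ∀ a ∈ anyBlockO142, a ∈ anyBlockO242 → a ∈ anyBlockO342 → a ∈ anyBlockO442 → a ∈ anyBlockO542 →
    a = (4, 2) ∨ a = (2, 2) ∨ a = (2, 1) ∨ a = (2, 3) ∨ a = (1, 2) := by
  decide

end Witnesses

/-! ## §2 Any cell: the box theorems -/

section Boxes

variable {m n : ℕ} {S : List Face} {h : Face}

/-- Placement of a frame block that misses the reference position `a₀` of the removed cell, under `S ⊆ {h, a₀ + v}`.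
[cite: GlazmanManolescu2019, §2.1 (finite domains of faces), §4.2 (translation invariance)] -/
theorem block_hroot_subset_boxMinus_of_not_mem (B : List Face) (a₀ : Face)
    (hB : ∀ a ∈ B, 0 ≤ a.1 ∧ a.1 ≤ 6 ∧ -1 ≤ a.2 ∧ a.2 ≤ 5 ∧ a ≠ (3, 2)) (ha₀ : a₀ ∉ B)
    (hW : 3 ≤ h.1) (hE : h.1 + 4 ≤ m) (hS : 3 ≤ h.2) (hN : h.2 + 4 ≤ n)
    (hSn : ∀ s ∈ S, s = h ∨ s = (a₀.1 + (h.1 - 3), a₀.2 + (h.2 - 2))) :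
    ∀ e ∈ B.map (Face.shiftBy (refShift (h.1 + 1, h.2))), e ∈ boxMinus m n S :=
  block_hroot_subset_boxMinus_pair B 0 6 (-1) 5 a₀ a₀
    (fun a ha => by
      obtain ⟨b1, b2, b3, b4, b5⟩ := hB a ha
      exact ⟨b1, b2, b3, b4, b5, fun e => ha₀ (e ▸ ha), fun e => ha₀ (e ▸ ha)⟩)
    (by omega) (by omega) (by omega) (by omega)
    (fun s hs => by rcases hSn s hs with e | e <;> [exact Or.inl e; exact Or.inr (Or.inl e)])

/-- ★★★★★ **ANY CELL, UNDER ROUTE.** Hole `h` three cells from every wall; `c` ANY cell other than the root plaquette `(h.1 + 1, h.2)`, the far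
cell `(h.1 − 1, h.2)` and the far cell's three doors `(h.1 − 1, h.2 − 1)`, `(h.1 − 1, h.2 + 1)`, `(h.1 − 2, h.2)`; `S ∋ h` any list inside
`{h, c}`. Then the far cell carries a wound class-`B2a` UNDER-walk, `w₁`-free AND `w₂`-free off it.
[cite: GlazmanManolescu2019, §1 (Fig. 2 and the remark after eq. (1)), §2.1, §4.2, Lemma 2.1]
[cite: Glazman2015WeightedSAW, Lemma 3.1 (proof, pp. 6–7)] [cite: CourantRobbins1958, Ch. V Appendix §2 (the even–odd rule)] -/
theorem exists_under_unmarked_of_anyCell (hW : 3 ≤ h.1) (hE : h.1 + 4 ≤ m) (hS : 3 ≤ h.2) (hN : h.2 + 4 ≤ n) {c : Face}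
    (hcw : c ≠ (h.1 + 1, h.2)) (hcf : c ≠ (h.1 - 1, h.2)) (hcs : c ≠ (h.1 - 1, h.2 - 1)) (hcn : c ≠ (h.1 - 1, h.2 + 1))
    (hcww : c ≠ (h.1 - 2, h.2)) (hSn : ∀ s ∈ S, s = h ∨ s = c)
    (hr : RootedFace (dom (boxMinus m n S)) (Face.side (h.1 + 1, h.2) .W) (farW (h.1 + 1, h.2))) (θ : ℝ) :
    ∃ (ω : ΩG (dom (boxMinus m n S)) (Face.side (h.1 + 1, h.2) .W) (farW (h.1 + 1, h.2))) (hb : ω.IsB2a),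
      ω.2.firstSideG = .S ∧ ω.WE (fun _ => θ) ≠ excursionWinding θ ω.2.firstSideG (ω.z1 hr hb) ω.1 ∧
        (ω.2.W1FreeOff (farW (h.1 + 1, h.2)) ∧ ω.2.W2FreeOff (farW (h.1 + 1, h.2))) := by
  -- the removed cell in reference coordinates
  set a₀ : Face := (c.1 - (h.1 - 3), c.2 - (h.2 - 2)) with ha₀
  have hSn' : ∀ s ∈ S, s = h ∨ s = (a₀.1 + (h.1 - 3), a₀.2 + (h.2 - 2)) := by
    intro s hs
    rcases hSn s hs with e | e
    · exact Or.inl e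
    · right; rw [e]; exact Prod.ext (by simp only [ha₀]; ring) (by simp only [ha₀]; ring)
  have key : ¬ (a₀ ∈ anyBlockU142 ∧ a₀ ∈ anyBlockU242 ∧ a₀ ∈ anyBlockU342 ∧ a₀ ∈ anyBlockU442) := by
    rintro ⟨h1, h2, h3, h4⟩
    rcases anyCell_under_cover a₀ h1 h2 h3 h4 with e | e | e | e | e <;>
      (have e' := Prod.ext_iff.1 e; rw [ha₀] at e'; simp only at e')
    · exact hcw (Prod.ext (by simp only; omega) (by simp only; omega))
    · exact hcf (Prod.ext (by simp only; omega) (by simp only; omega))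
    · exact hcs (Prod.ext (by simp only; omega) (by simp only; omega))
    · exact hcn (Prod.ext (by simp only; omega) (by simp only; omega))
    · exact hcww (Prod.ext (by simp only; omega) (by simp only; omega))
  simp only [not_and_or] at key
  rcases key with hm | hm | hm | hm
  · exact exists_under_unmarked_of_anyBlockU1
      (block_hroot_subset_boxMinus_of_not_mem anyBlockU142 a₀ anyBlockU142_bounds hm hW hE hS hN hSn') hr θ
  · exact exists_under_unmarked_of_anyBlockU2
      (block_hroot_subset_boxMinus_of_not_mem anyBlockU242 a₀ anyBlockU242_bounds hm hW hE hS hN hSn') hr θ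
  · exact exists_under_unmarked_of_anyBlockU3
      (block_hroot_subset_boxMinus_of_not_mem anyBlockU342 a₀ anyBlockU342_bounds hm hW hE hS hN hSn') hr θ
  · exact exists_under_unmarked_of_anyBlockU4
      (block_hroot_subset_boxMinus_of_not_mem anyBlockU442 a₀ anyBlockU442_bounds hm hW hE hS hN hSn') hr θ

/-- ★★★★★ **ANY CELL, OVER ROUTE** (same hypotheses): a wound class-`B2a` OVER-walk, free in both classes.
[cite: GlazmanManolescu2019, §1 (Fig. 2 and the remark after eq. (1)), §2.1, §4.2, Lemma 2.1]
[cite: Glazman2015WeightedSAW, Lemma 3.1 (proof, pp. 6–7)] [cite: CourantRobbins1958, Ch. V Appendix §2 (the even–odd rule)] -/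
theorem exists_over_unmarked_of_anyCell (hW : 3 ≤ h.1) (hE : h.1 + 4 ≤ m) (hS : 3 ≤ h.2) (hN : h.2 + 4 ≤ n) {c : Face}
    (hcw : c ≠ (h.1 + 1, h.2)) (hcf : c ≠ (h.1 - 1, h.2)) (hcs : c ≠ (h.1 - 1, h.2 - 1)) (hcn : c ≠ (h.1 - 1, h.2 + 1))
    (hcww : c ≠ (h.1 - 2, h.2)) (hSn : ∀ s ∈ S, s = h ∨ s = c)
    (hr : RootedFace (dom (boxMinus m n S)) (Face.side (h.1 + 1, h.2) .W) (farW (h.1 + 1, h.2))) (θ : ℝ) :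
    ∃ (ω : ΩG (dom (boxMinus m n S)) (Face.side (h.1 + 1, h.2) .W) (farW (h.1 + 1, h.2))) (hb : ω.IsB2a),
      ω.2.firstSideG = .N ∧ ω.WE (fun _ => θ) ≠ excursionWinding θ ω.2.firstSideG (ω.z1 hr hb) ω.1 ∧
        (ω.2.W1FreeOff (farW (h.1 + 1, h.2)) ∧ ω.2.W2FreeOff (farW (h.1 + 1, h.2))) := by
  set a₀ : Face := (c.1 - (h.1 - 3), c.2 - (h.2 - 2)) with ha₀
  have hSn' : ∀ s ∈ S, s = h ∨ s = (a₀.1 + (h.1 - 3), a₀.2 + (h.2 - 2)) := by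
    intro s hs
    rcases hSn s hs with e | e
    · exact Or.inl e
    · right; rw [e]; exact Prod.ext (by simp only [ha₀]; ring) (by simp only [ha₀]; ring)
  have key : ¬ (a₀ ∈ anyBlockO142 ∧ a₀ ∈ anyBlockO242 ∧ a₀ ∈ anyBlockO342 ∧ a₀ ∈ anyBlockO442 ∧ a₀ ∈ anyBlockO542) := by
    rintro ⟨h1, h2, h3, h4, h5⟩
    rcases anyCell_over_cover a₀ h1 h2 h3 h4 h5 with e | e | e | e | e <;>
      (have e' := Prod.ext_iff.1 e; rw [ha₀] at e'; simp only at e')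
    · exact hcw (Prod.ext (by simp only; omega) (by simp only; omega))
    · exact hcf (Prod.ext (by simp only; omega) (by simp only; omega))
    · exact hcs (Prod.ext (by simp only; omega) (by simp only; omega))
    · exact hcn (Prod.ext (by simp only; omega) (by simp only; omega))
    · exact hcww (Prod.ext (by simp only; omega) (by simp only; omega))
  simp only [not_and_or] at key
  rcases key with hm | hm | hm | hm | hm
  · exact exists_over_unmarked_of_anyBlockO1
      (block_hroot_subset_boxMinus_of_not_mem anyBlockO142 a₀ anyBlockO142_bounds hm hW hE hS hN hSn') hr θ
  · exact exists_over_unmarked_of_anyBlockO2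
      (block_hroot_subset_boxMinus_of_not_mem anyBlockO242 a₀ anyBlockO242_bounds hm hW hE hS hN hSn') hr θ
  · exact exists_over_unmarked_of_anyBlockO3
      (block_hroot_subset_boxMinus_of_not_mem anyBlockO342 a₀ anyBlockO342_bounds hm hW hE hS hN hSn') hr θ
  · exact exists_over_unmarked_of_anyBlockO4
      (block_hroot_subset_boxMinus_of_not_mem anyBlockO442 a₀ anyBlockO442_bounds hm hW hE hS hN hSn') hr θ
  · exact exists_over_unmarked_of_anyBlockO5
      (block_hroot_subset_boxMinus_of_not_mem anyBlockO542 a₀ anyBlockO542_bounds hm hW hE hS hN hSn') hr θ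

/-- ★★★★★ **ANY CELL KILLS NOTHING.** Hole three cells from every wall, ONE further cell `c` removed — any cell other than the root
plaquette, the far cell and the far cell's three doors — (`S ∋ h` inside `{h, c}`): at every angle NONE of the four universal kill
statements of LAW L holds at the far cell. In the interior LAW L's single-cell table has no entries but the three doors.
[cite: GlazmanManolescu2019, §1 (Fig. 2 and the remark after eq. (1)), §2.1, §4.2, Lemma 2.1]
[cite: Glazman2015WeightedSAW, Lemma 3.1 (proof, pp. 6–7)] [cite: CourantRobbins1958, Ch. V Appendix §2 (the even–odd rule)] -/
theorem lawL_box_anyCell_not_killed (hW : 3 ≤ h.1) (hE : h.1 + 4 ≤ m) (hS : 3 ≤ h.2) (hN : h.2 + 4 ≤ n) {c : Face}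
    (hcw : c ≠ (h.1 + 1, h.2)) (hcf : c ≠ (h.1 - 1, h.2)) (hcs : c ≠ (h.1 - 1, h.2 - 1)) (hcn : c ≠ (h.1 - 1, h.2 + 1))
    (hcww : c ≠ (h.1 - 2, h.2)) (hSn : ∀ s ∈ S, s = h ∨ s = c)
    (hr : RootedFace (dom (boxMinus m n S)) (Face.side (h.1 + 1, h.2) .W) (farW (h.1 + 1, h.2))) (θ : ℝ) :
    (¬ ∀ (ω : ΩG (dom (boxMinus m n S)) (Face.side (h.1 + 1, h.2) .W) (farW (h.1 + 1, h.2))) (hb : ω.IsB2a),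
        ω.2.firstSideG = .S → ω.WE (fun _ => θ) ≠ excursionWinding θ ω.2.firstSideG (ω.z1 hr hb) ω.1 →
          ¬ω.2.W2FreeOff (farW (h.1 + 1, h.2))) ∧
      (¬ ∀ (ω : ΩG (dom (boxMinus m n S)) (Face.side (h.1 + 1, h.2) .W) (farW (h.1 + 1, h.2))) (hb : ω.IsB2a),
        ω.2.firstSideG = .N → ω.WE (fun _ => θ) ≠ excursionWinding θ ω.2.firstSideG (ω.z1 hr hb) ω.1 →
          ¬ω.2.W1FreeOff (farW (h.1 + 1, h.2))) ∧
      (¬ ∀ (ω : ΩG (dom (boxMinus m n S)) (Face.side (h.1 + 1, h.2) .W) (farW (h.1 + 1, h.2))) (hb : ω.IsB2a),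
        ω.2.firstSideG = .S → ω.WE (fun _ => θ) ≠ excursionWinding θ ω.2.firstSideG (ω.z1 hr hb) ω.1 →
          ¬ω.2.W1FreeOff (farW (h.1 + 1, h.2))) ∧
      (¬ ∀ (ω : ΩG (dom (boxMinus m n S)) (Face.side (h.1 + 1, h.2) .W) (farW (h.1 + 1, h.2))) (hb : ω.IsB2a),
        ω.2.firstSideG = .N → ω.WE (fun _ => θ) ≠ excursionWinding θ ω.2.firstSideG (ω.z1 hr hb) ω.1 →
          ¬ω.2.W2FreeOff (farW (h.1 + 1, h.2))) := by
  obtain ⟨ωu, hu, hus, huw, hu1, hu2⟩ := exists_under_unmarked_of_anyCell hW hE hS hN hcw hcf hcs hcn hcww hSn hr θ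
  obtain ⟨ωo, ho, hos, how, ho1, ho2⟩ := exists_over_unmarked_of_anyCell hW hE hS hN hcw hcf hcs hcn hcww hSn hr θ
  exact ⟨fun hk => hk ωu hu hus huw hu2, fun hk => hk ωo ho hos how ho1, fun hk => hk ωu hu hus huw hu1,
    fun hk => hk ωo ho hos how ho2⟩

end Boxes

end Literature.Barriers.CriticalPhenomena.PlaquetteWalk
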